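import Literature.NumberTheory.Transcendental.RoySmallValueProductLemma
import Literature.NumberTheory.Transcendental.RoySmallValueLiouville
import Literature.NumberTheory.Transcendental.RoySmallValueGaussNorm
import HarnessLib

/-!
# Roy's small value estimate for `𝔾ₐ × 𝔾ₘ` — heights of the linear factors of an integer polynomial

Topic `Literature/NumberTheory/Transcendental`. Part of the formalisation of the proof of Roy 2013,
Theorem 1.1 (named fact `roy2013_thm_1_1`, `RoySmallValueEstimates.lean`), seat B (an
elimination-free reorganisation of §§2, 5–6 of D. Roy, *A small value estimate for `𝔾ₐ × 𝔾ₘ`*,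
Mathematika 59 (2013) 333–363 = arXiv:1301.0663).

Roy bounds the height of the zero-dimensional cycle cut out by two integer forms `P, Q` through the
arithmetic Bézout inequalities of Laurent–Roy 2001 (his Prop. 2.2 (ii), used in Prop. 6.2, and the
estimate `T h_B(Z) ≤ h_B(F) + 2 log(3) D³` in the proof of Prop. 6.4). In this development the
common zeros of `P, Q` appear as the linear factors `ℓ_j(r) = ∑_i c_{ji} r_i` of an integer
polynomial `F₀(r)` (a determinant built from `P, Q`), and all height information is extracted from
the following **Gelfond–Mahler inequality**: if `F₀ ∈ ℤ[r] ∖ {0}` factors over a number field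
`K` as `F₀ = a ∏_j ℓ_j^{e_j}`, then

  `∏_j H_K(c_j)^{e_j} ≤ L(F₀)^{[K:ℚ]}`,  i.e.  `∑_j e_j h_K(c_j) ≤ [K:ℚ] log L(F₀)`,

where `H_K, h_K` are Mathlib's heights of the coefficient vectors `c_j` relative to `K` and
`L(F₀) = ∑ |coefficients|`. Proof: at each embedding `σ : K → ℂ` the product lemma
(`exists_torus_prod_linear_ge`) gives a point `z` of the unit torus with
`|σ a| ∏_j (max_i |σ c_{ji}|)^{e_j} ≤ |F₀(z)| ≤ L(F₀)`; at each finite place `w` Gauss's lemma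
(`iSup_coeff_mul`) gives `|a|_w ∏_j (max_i |c_{ji}|_w)^{e_j} = ‖F₀‖_w ≤ 1`; multiplying over all
places, the product formula removes `a`.

* `norm_mul_prod_iSup_le` — the archimedean estimate at an embedding;
* `finitePlace_mul_prod_iSup_le` — the non-archimedean estimate at a finite place;
* `prod_mulHeight_pow_le` — the multiplicative global inequality;
* `sum_mul_logHeight_le` — its logarithmic form.

Everything is proved; no definitions, no named facts.

## References

* [Roy2013] D. Roy, *A small value estimate for 𝔾ₐ × 𝔾ₘ*, Mathematika 59 (2013), 333–363
  (arXiv:1301.0663), Prop. 2.2 (ii), Prop. 6.2, Prop. 6.4 (the height estimates this replaces).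
* [LaurentRoy2001] M. Laurent, D. Roy, J. reine angew. Math. 536 (2001), 65–114, §§4–5.
-/

noncomputable section

open MvPolynomial NumberField Height Finset

namespace Literature.NumberTheory.Transcendental

namespace Roy2013

variable {K : Type*} [Field K] [NumberField K] {ι : Type*} [Fintype ι] {J : Type*} [Fintype J]

/-! ### The archimedean estimate -/

omit [NumberField K] in
/-- Mapping the factorisation to `ℂ` along an embedding. [folklore] -/
theorem map_factorisation (σ : K →+* ℂ) {F₀ : MvPolynomial ι ℤ} {a : K} {c : J → ι → K}
    {e : J → ℕ} (hfac : map (Int.castRingHom K) F₀ = C a * ∏ j, (∑ i, C (c j i) * X i) ^ e j) :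
    map (Int.castRingHom ℂ) F₀ = C (σ a) * ∏ j, (∑ i, C (σ (c j i)) * X i) ^ e j := by
  have hcomp : (σ.comp (Int.castRingHom K)) = Int.castRingHom ℂ := RingHom.ext_int _ _
  rw [← hcomp, ← MvPolynomial.map_map, hfac]
  simp only [map_mul, map_C, map_prod, map_pow, map_sum, map_X]

omit [NumberField K] in
/-- **Archimedean estimate.** If `F₀ = a ∏_j ℓ_j^{e_j}` over `K` with `ℓ_j = ∑_i c_{ji} X_i`, then
for every embedding `σ : K → ℂ`, `|σ a| ∏_j (max_i |σ c_{ji}|)^{e_j} ≤ L(F₀) = ∑ |coeff F₀|`.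
[cite: Roy2013, Prop. 2.2 (ii) — replaced; via the product lemma on the unit torus] -/
theorem norm_mul_prod_iSup_le [Nonempty ι] (σ : K →+* ℂ) {F₀ : MvPolynomial ι ℤ} {a : K}
    {c : J → ι → K} {e : J → ℕ}
    (hfac : map (Int.castRingHom K) F₀ = C a * ∏ j, (∑ i, C (c j i) * X i) ^ e j) :
    ‖σ a‖ * ∏ j, (⨆ i, ‖σ (c j i)‖) ^ e j ≤ ∑ m ∈ F₀.support, |((coeff m F₀ : ℤ) : ℝ)| := by
  classical
  -- distinguished coefficients: the largest ones
  have hmax : ∀ j, ∃ i, ‖σ (c j i)‖ = ⨆ i, ‖σ (c j i)‖ := fun j =>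
    exists_eq_ciSup_of_finite (f := fun i => ‖σ (c j i)‖)
  choose i₀ hi₀ using hmax
  obtain ⟨z, hz, hprod⟩ := exists_torus_prod_linear_ge (fun j i => σ (c j i)) e i₀ one_pos
  simp only [one_mul, hi₀] at hprod
  -- `F₀(z) = σ a ∏ ℓ_j(z)^{e_j}`
  have heval : eval z (map (Int.castRingHom ℂ) F₀) = σ a * ∏ j, (∑ i, σ (c j i) * z i) ^ e j := by
    rw [map_factorisation σ hfac]
    simp only [map_mul, eval_C, map_prod, map_pow, map_sum, eval_X]
  -- `|F₀(z)| ≤ L(F₀)` on the unit torus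
  have hbound : ‖eval z (map (Int.castRingHom ℂ) F₀)‖ ≤ ∑ m ∈ F₀.support, |((coeff m F₀ : ℤ) : ℝ)| := by
    rw [eval_map, eval₂_eq]
    refine (norm_sum_le _ _).trans (sum_le_sum fun m _ => ?_)
    rw [norm_mul, norm_prod]
    have h1 : ∏ i ∈ m.support, ‖z i ^ m i‖ = 1 :=
      prod_eq_one fun i _ => by rw [norm_pow, hz, one_pow]
    rw [h1, mul_one, eq_intCast, Complex.norm_intCast]
  calc ‖σ a‖ * ∏ j, (⨆ i, ‖σ (c j i)‖) ^ e j ≤ ‖σ a‖ * ∏ j, ‖∑ i, σ (c j i) * z i‖ ^ e j :=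
        mul_le_mul_of_nonneg_left hprod (norm_nonneg _)
    _ = ‖eval z (map (Int.castRingHom ℂ) F₀)‖ := by
        rw [heval, norm_mul, norm_prod]; simp_rw [norm_pow]
    _ ≤ _ := hbound

/-! ### The non-archimedean estimate -/

/-- **Non-archimedean estimate.** If `F₀ = a ∏_j ℓ_j^{e_j}` over `K` with `ℓ_j = ∑_i c_{ji} X_i`,
then at every finite place `w` of `K`, `|a|_w ∏_j (max_i |c_{ji}|_w)^{e_j} ≤ 1` (Gauss's lemma:
the left side is the coefficient norm of `F₀`, whose coefficients are integers).
[cite: Roy2013, Prop. 2.2 (ii) — replaced; via Gauss's lemma] -/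
theorem finitePlace_mul_prod_iSup_le [LinearOrder ι] (w : FinitePlace K) {F₀ : MvPolynomial ι ℤ}
    {a : K} {c : J → ι → K} {e : J → ℕ}
    (hfac : map (Int.castRingHom K) F₀ = C a * ∏ j, (∑ i, C (c j i) * X i) ^ e j) :
    w a * ∏ j, (⨆ i, w (c j i)) ^ e j ≤ 1 := by
  have hv : IsNonarchimedean w.val := FinitePlace.add_le w
  have key : (⨆ s : (map (Int.castRingHom K) F₀).support,
      w.val (coeff (s : ι →₀ ℕ) (map (Int.castRingHom K) F₀))) = w a * ∏ j, (⨆ i, w (c j i)) ^ e j := by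
    rw [hfac, iSup_coeff_C_mul hv, iSup_coeff_finset_prod hv]
    congr 1
    refine prod_congr rfl fun j _ => ?_
    rw [iSup_coeff_pow hv, iSup_coeff_linearForm]
    rfl
  rw [← key]
  rcases isEmpty_or_nonempty (map (Int.castRingHom K) F₀).support with h | h
  · rw [Real.iSup_of_isEmpty]; exact zero_le_one
  · refine ciSup_le fun s => ?_
    rw [coeff_map]
    exact finitePlace_intCast_le_one w _

/-! ### The global inequality -/

/-- **Gelfond–Mahler inequality for the linear factors of an integer polynomial, multiplicative
form.** Let `K` be a number field, `F₀ ∈ ℤ[X_i : i ∈ ι] ∖ {0}` and suppose that over `K`,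
`F₀ = a ∏_j ℓ_j^{e_j}` with linear forms `ℓ_j = ∑_i c_{ji} X_i`, `c_j ≠ 0`. Then
`∏_j H_K(c_j)^{e_j} ≤ L(F₀)^{[K:ℚ]}` (`H_K = Height.mulHeight` relative to `K`,
`L(F₀) = ∑ |coefficients|`). Replaces the height half of the arithmetic Bézout estimates of
Roy 2013 (Prop. 2.2 (ii), Prop. 6.4). [cite: Roy2013, Prop. 2.2 (ii) and Prop. 6.4 — replaced] -/
theorem prod_mulHeight_pow_le [Nonempty ι] [LinearOrder ι] {F₀ : MvPolynomial ι ℤ} (hF₀ : F₀ ≠ 0)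
    {a : K} {c : J → ι → K} (hc : ∀ j, c j ≠ 0) {e : J → ℕ}
    (hfac : map (Int.castRingHom K) F₀ = C a * ∏ j, (∑ i, C (c j i) * X i) ^ e j) :
    ∏ j, mulHeight (c j) ^ e j ≤ (∑ m ∈ F₀.support, |((coeff m F₀ : ℤ) : ℝ)|) ^ Module.finrank ℚ K := by
  classical
  set L : ℝ := ∑ m ∈ F₀.support, |((coeff m F₀ : ℤ) : ℝ)| with hL
  -- `a ≠ 0`
  have ha : a ≠ 0 := by
    rintro rfl
    rw [C_0, zero_mul] at hfac
    exact hF₀ (map_injective _ Int.cast_injective (by rw [hfac, map_zero]))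
  -- local quantities
  set N : InfinitePlace K → J → ℝ := fun v j => ⨆ i, v (c j i) with hN
  set M : FinitePlace K → J → ℝ := fun w j => ⨆ i, w (c j i) with hM
  have hNnn : ∀ v j, 0 ≤ N v j := fun v j => Real.iSup_nonneg fun i => apply_nonneg _ _
  have hMnn : ∀ w j, 0 ≤ M w j := fun w j => Real.iSup_nonneg fun i => apply_nonneg _ _
  have hMfin : ∀ j, (fun w : FinitePlace K => M w j).HasFiniteMulSupport := fun j =>
    hasFiniteMulSupport_iSup_finitePlace' (hc j)
  have hMfin' : ∀ j, (fun w : FinitePlace K => M w j ^ e j).HasFiniteMulSupport := fun j =>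
    (hMfin j).pow (e j)
  -- heights of the `c_j`
  have hH : ∀ j, mulHeight (c j) = (∏ v : InfinitePlace K, N v j ^ v.mult) *
      ∏ᶠ w : FinitePlace K, M w j := fun j => NumberField.mulHeight_eq (hc j)
  -- the product of the heights, split into infinite and finite parts
  have hsplit : ∏ j, mulHeight (c j) ^ e j =
      (∏ v : InfinitePlace K, (∏ j, N v j ^ e j) ^ v.mult) *
        ∏ᶠ w : FinitePlace K, ∏ j, M w j ^ e j := by
    simp_rw [hH, mul_pow, prod_mul_distrib]
    congr 1
    · -- `∏_j (∏_v N^{mult})^{e} = ∏_v (∏_j N^{e})^{mult}`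
      have h1 : ∀ j, (∏ v : InfinitePlace K, N v j ^ v.mult) ^ e j =
          ∏ v : InfinitePlace K, (N v j ^ e j) ^ v.mult := fun j => by
        rw [← prod_pow]
        refine prod_congr rfl fun v _ => ?_
        rw [← pow_mul, ← pow_mul, mul_comm]
      have h2 : ∀ v : InfinitePlace K, (∏ j, N v j ^ e j) ^ v.mult =
          ∏ j, (N v j ^ e j) ^ v.mult := fun v => (prod_pow _ _ _).symm
      simp_rw [h1, h2]
      exact prod_comm
    · have h1 : ∀ j, (∏ᶠ w : FinitePlace K, M w j) ^ e j = ∏ᶠ w : FinitePlace K, M w j ^ e j :=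
        fun j => finprod_pow (hMfin j) (e j)
      simp_rw [h1]
      exact prod_finprod_comm univ (fun j w => M w j ^ e j) fun j _ => hMfin' j
  -- the product formula for `a`
  have hpf := prod_abs_eq_one ha
  -- infinite part: `∏_v (v a ∏_j N v j^{e_j})^{mult v} = ∏_σ (…) ≤ L^{[K:ℚ]}`
  have hinf : (∏ v : InfinitePlace K, v a ^ v.mult) *
      ∏ v : InfinitePlace K, (∏ j, N v j ^ e j) ^ v.mult ≤ L ^ Module.finrank ℚ K := by
    rw [← prod_mul_distrib]
    have hfib : ∏ v : InfinitePlace K, (v a ^ v.mult * (∏ j, N v j ^ e j) ^ v.mult) =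
        ∏ σ : K →+* ℂ, (‖σ a‖ * ∏ j, (⨆ i, ‖σ (c j i)‖) ^ e j) := by
      rw [← Finset.prod_fiberwise univ (fun σ : K →+* ℂ => InfinitePlace.mk σ)]
      refine prod_congr rfl fun v _ => ?_
      rw [← mul_pow, ← InfinitePlace.card_filter_mk_eq v, ← prod_const]
      refine prod_congr rfl fun σ hσ => ?_
      rw [mem_filter] at hσ
      rw [← hσ.2]
      rfl
    rw [hfib, ← Embeddings.card K ℂ, ← Finset.card_univ, ← prod_const]
    refine prod_le_prod (fun σ _ => mul_nonneg (norm_nonneg _)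
      (prod_nonneg fun j _ => pow_nonneg (Real.iSup_nonneg fun i => norm_nonneg _) _)) ?_
    exact fun σ _ => norm_mul_prod_iSup_le σ hfac
  -- finite part: `∏ᶠ_w (w a ∏_j M w j^{e_j}) ≤ 1`
  have hfinprod : (∏ᶠ w : FinitePlace K, w a) * ∏ᶠ w : FinitePlace K, ∏ j, M w j ^ e j ≤ 1 := by
    have hfs : (fun w : FinitePlace K => ∏ j, M w j ^ e j).HasFiniteMulSupport :=
      Function.HasFiniteMulSupport.prod (fun j => hMfin' j) univ
    rw [← finprod_mul_distrib (FinitePlace.hasFiniteMulSupport ha) hfs]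
    have key : ∀ w : FinitePlace K,
        (0 : ℝ) ≤ w a * ∏ j, M w j ^ e j ∧ w a * ∏ j, M w j ^ e j ≤ 1 := fun w =>
      ⟨mul_nonneg (apply_nonneg _ _) (prod_nonneg fun j _ => pow_nonneg (hMnn w j) _),
        finitePlace_mul_prod_iSup_le w hfac⟩
    have hind := finprod_induction (p := fun r : ℝ => 0 ≤ r ∧ r ≤ 1) ⟨zero_le_one, le_rfl⟩
      (fun r t hr ht => ⟨mul_nonneg hr.1 ht.1, mul_le_one₀ hr.2 ht.1 ht.2⟩) key
    exact hind.2
  -- assemble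
  have hfin_nn : 0 ≤ ∏ᶠ w : FinitePlace K, ∏ j, M w j ^ e j :=
    finprod_nonneg fun w => prod_nonneg fun j _ => pow_nonneg (hMnn w j) _
  have hinf_nn : 0 ≤ ∏ v : InfinitePlace K, (∏ j, N v j ^ e j) ^ v.mult :=
    prod_nonneg fun v _ => pow_nonneg (prod_nonneg fun j _ => pow_nonneg (hNnn v j) _) _
  have hLnn : 0 ≤ L ^ Module.finrank ℚ K := pow_nonneg (sum_nonneg fun m _ => abs_nonneg _) _
  calc ∏ j, mulHeight (c j) ^ e j
      = ((∏ v : InfinitePlace K, (∏ j, N v j ^ e j) ^ v.mult) *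
          ∏ᶠ w : FinitePlace K, ∏ j, M w j ^ e j) *
          ((∏ v : InfinitePlace K, v a ^ v.mult) * ∏ᶠ w : FinitePlace K, w a) := by
        rw [hsplit, hpf, mul_one]
    _ = ((∏ v : InfinitePlace K, v a ^ v.mult) *
          ∏ v : InfinitePlace K, (∏ j, N v j ^ e j) ^ v.mult) *
          ((∏ᶠ w : FinitePlace K, w a) * ∏ᶠ w : FinitePlace K, ∏ j, M w j ^ e j) := by ring
    _ ≤ L ^ Module.finrank ℚ K * 1 :=
        mul_le_mul hinf hfinprod (mul_nonneg (finprod_nonneg fun w => apply_nonneg _ _) hfin_nn)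
          hLnn
    _ = L ^ Module.finrank ℚ K := mul_one _

omit [Fintype ι] in
/-- `L(F₀) ≥ 1` for a non-zero integer polynomial. [folklore] -/
theorem one_le_sum_abs_coeff {F₀ : MvPolynomial ι ℤ} (hF₀ : F₀ ≠ 0) :
    1 ≤ ∑ m ∈ F₀.support, |((coeff m F₀ : ℤ) : ℝ)| := by
  obtain ⟨m, hm⟩ := support_nonempty.mpr hF₀
  have h1 : (1 : ℝ) ≤ |((coeff m F₀ : ℤ) : ℝ)| := by
    have := mem_support_iff.mp hm
    rw [← Int.cast_abs]
    exact_mod_cast Int.one_le_abs this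
  exact h1.trans (single_le_sum (f := fun m => |((coeff m F₀ : ℤ) : ℝ)|) (fun m _ => abs_nonneg _) hm)

/-- **Gelfond–Mahler inequality, logarithmic form**: with the notation of
`prod_mulHeight_pow_le`, `∑_j e_j h_K(c_j) ≤ [K:ℚ] log L(F₀)` (`h_K = Height.logHeight` relative to
`K`). [cite: Roy2013, Prop. 2.2 (ii) and Prop. 6.4 — replaced] -/
theorem sum_mul_logHeight_le [Nonempty ι] [LinearOrder ι] {F₀ : MvPolynomial ι ℤ} (hF₀ : F₀ ≠ 0)
    {a : K} {c : J → ι → K} (hc : ∀ j, c j ≠ 0) {e : J → ℕ}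
    (hfac : map (Int.castRingHom K) F₀ = C a * ∏ j, (∑ i, C (c j i) * X i) ^ e j) :
    ∑ j, (e j : ℝ) * logHeight (c j) ≤
      Module.finrank ℚ K * Real.log (∑ m ∈ F₀.support, |((coeff m F₀ : ℤ) : ℝ)|) := by
  have h := prod_mulHeight_pow_le hF₀ hc hfac
  have hL := one_le_sum_abs_coeff hF₀
  have hpos : ∀ j, 0 < mulHeight (c j) ^ e j := fun j => pow_pos (mulHeight_pos _) _
  have hlog := Real.log_le_log (prod_pos fun j _ => hpos j) h
  rw [Real.log_prod (fun j _ => (hpos j).ne'), Real.log_pow] at hlog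
  simp_rw [Real.log_pow] at hlog
  simpa only [logHeight_eq_log_mulHeight] using hlog

end Roy2013

end Literature.NumberTheory.Transcendental
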